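import Mathlib.Algebra.Order.Chebyshev
import Literature.MathematicalPhysics.QuantumLattice.TransferOperatorMinorisation
import Literature.MathematicalPhysics.QuantumLattice.TracePowerInequalities
import HarnessLib

/-!
# Gram matrices of MPS families through the transfer operator (FNW Lemma 5.2)

Sibling proof file of `Literature/MathematicalPhysics/QuantumLattice/LiebRobinson.lean`
(theorem-only: no definition, no named fact), a step towards the discharge of
`fannes_nachtergaele_werner_gap` (**hubbard.S16**; Fannes–Nachtergaele–Werner 1992, Thm. 6.4).
It provides the algebra behind FNW's Lemma 5.2 — the Gram matrix of the vectors
`w ↦ tr (B A^{w})` on `n` sites is governed by the `n`-th iterate of the transfer operator — in the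
normalised gauge `𝔼(𝟙) = 𝟙`, `𝔼†(ρ) = ρ` (`MatrixProductStatesGaugeProofs.lean`), with the
convergence of `𝔼ⁿ` to `X ↦ tr (ρ X) 𝟙` entering only through an explicit entrywise hypothesis
on `𝔼ⁿ(e_a e_dᵀ) - ρ_{da} 𝟙`:

* `sum_conj_trace_mul_trace_eq` — `Σ_{|s|=n} conj tr (X A^{s}) · tr (Y A^{s}) = Σ_{a,d} (Y 𝔼ⁿ(e_a e_dᵀ) Xᴴ)_{ad}`;
  `sum_conj_trace_mul_trace_eq_main_add` — `= tr (Xᴴ ρ Y) + remainder`;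
  `norm_gram_remainder_le` — `|remainder| ≤ δ (Σ|Y_{ij}|)(Σ|X_{ij}|)`;
* `trace_mul_transferOp_pow`, `sum_conjTranspose_wordProduct_mul_mul` — trace duality and the
  dual word formula `Σ_w (A^{w})† Y A^{w} = (𝔼†)ⁿ(Y)`; `wordProduct_append`;
* `posSemidef_algebraMap_trace_sub`, `posSemidef_one_sub_of_trace_eq_one`,
  `mul_sum_norm_sq_le_re_trace`, `re_trace_le_sum_norm_sq` — `λ 𝟙 ≤ ρ ≤ 𝟙` in quadratic form;
* `sum_wordProduct_mul_conjTranspose`, `sum_sum_norm_sq_mul_wordProduct`,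
  `sum_sum_norm_sq_wordProduct_mul_le` — `Σ_u A^{u}A^{u}† = 𝟙`, `Σ_u ‖X A^{u}‖₂² = ‖X‖₂²`,
  `Σ_t ‖A^{t} X‖₂² ≤ λ⁻¹ ‖X‖₂²` (the two auxiliary estimates in the proof of FNW Lemma 6.2);
* entrywise norm helpers `trace_conjTranspose_mul_self_eq` (with `trace_conjTranspose_mul_self_re`
  of `TracePowerInequalities.lean`), `sum_norm_sq_le`,
  `norm_trace_mul_le_sqrt_sum_mul_sqrt_sum`, `mul_single_one_mul_apply`.

## Source

* M. Fannes, B. Nachtergaele, R. F. Werner, *Finitely correlated states on quantum spin chains*,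
  Comm. Math. Phys. **144** (1992) 443–490 (held: `paper:doi-10-1007-bf02099178`), §5:
  eq. (5.3) (`Σ v(μ)v(μ)^* = 𝟙`, `Σ v(μ)^* ρ v(μ) = ρ`), Lemma 5.1–5.2 (p. 465–466: the Gram matrix
  of `Γ_n(B)` and its limit `tr (ρ B^* C)` up to `O(a(n))`), and §6, proof of Lemma 6.2 (p. 476–477:
  the estimates `Σ ‖v(μ^ℓ)^* Φ(μ^r)‖²_ρ ≤ …` and `Σ v(μ^r)^* ρ v(μ^r) = ρ`).
  [FannesNachtergaeleWernerCMP1992]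
-/

noncomputable section

open Matrix
open scoped ComplexOrder MatrixOrder

namespace Literature.MathematicalPhysics.QuantumLattice

section QLattice

variable {q D : ℕ}

/-! ### Entrywise norms of matrices -/

/-- `tr (Xᴴ X)` is the real number `Σ_{i,j} |X_{ij}|²`. [folklore] -/
theorem trace_conjTranspose_mul_self_eq (X : Matrix (Fin D) (Fin D) ℂ) :
    (Xᴴ * X).trace = ((∑ i, ∑ j, ‖X i j‖ ^ 2 : ℝ) : ℂ) := by
  rw [← trace_conjTranspose_mul_self_re]
  exact Complex.ext rfl (by
    rw [Complex.ofReal_im]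
    have h := (posSemidef_conjTranspose_mul_self X).trace_nonneg
    exact ((Complex.nonneg_iff.1 h).2).symm)

/-- The entrywise `ℓ¹` norm is controlled by the Hilbert–Schmidt norm:
`(Σ_{i,j} |X_{ij}|)² ≤ D² Σ_{i,j} |X_{ij}|²` (Cauchy–Schwarz). [folklore] -/
theorem sum_norm_sq_le (X : Matrix (Fin D) (Fin D) ℂ) :
    (∑ i, ∑ j, ‖X i j‖) ^ 2 ≤ (D : ℝ) ^ 2 * ∑ i, ∑ j, ‖X i j‖ ^ 2 := by
  have h := sq_sum_le_card_mul_sum_sq (s := (Finset.univ : Finset (Fin D × Fin D)))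
    (f := fun p => ‖X p.1 p.2‖)
  simp only [Finset.card_univ, Fintype.card_prod, Fintype.card_fin, Nat.cast_mul] at h
  rw [← Finset.univ_product_univ, Finset.sum_product, Finset.sum_product] at h
  simpa [sq] using h

/-- Cauchy–Schwarz for the trace pairing: `|tr (X Y)| ≤ ‖X‖₂ ‖Y‖₂` (Hilbert–Schmidt norms).
[folklore] -/
theorem norm_trace_mul_le_sqrt_sum_mul_sqrt_sum (X Y : Matrix (Fin D) (Fin D) ℂ) :
    ‖(X * Y).trace‖ ≤ Real.sqrt (∑ i, ∑ j, ‖X i j‖ ^ 2) * Real.sqrt (∑ i, ∑ j, ‖Y i j‖ ^ 2) := by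
  have h1 : ‖(X * Y).trace‖ ≤ ∑ i, ∑ j, ‖X i j‖ * ‖Y j i‖ := by
    simp only [trace, diag_apply, mul_apply]
    refine (norm_sum_le _ _).trans (Finset.sum_le_sum fun i _ => ?_)
    refine (norm_sum_le _ _).trans (Finset.sum_le_sum fun j _ => ?_)
    rw [norm_mul]
  have h2 : (∑ i, ∑ j, ‖X i j‖ * ‖Y j i‖) ^ 2 ≤
      (∑ i, ∑ j, ‖X i j‖ ^ 2) * (∑ i, ∑ j, ‖Y i j‖ ^ 2) := by
    have h := Finset.sum_mul_sq_le_sq_mul_sq (Finset.univ : Finset (Fin D × Fin D))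
      (fun p => ‖X p.1 p.2‖) (fun p => ‖Y p.2 p.1‖)
    rw [← Finset.univ_product_univ, Finset.sum_product, Finset.sum_product,
      Finset.sum_product] at h
    have e : ∑ i, ∑ j, ‖Y j i‖ ^ 2 = ∑ i, ∑ j, ‖Y i j‖ ^ 2 := Finset.sum_comm
    rw [e] at h
    exact h
  have h3 : ∑ i, ∑ j, ‖X i j‖ * ‖Y j i‖ ≤
      Real.sqrt (∑ i, ∑ j, ‖X i j‖ ^ 2) * Real.sqrt (∑ i, ∑ j, ‖Y i j‖ ^ 2) := by
    rw [← Real.sqrt_mul (by positivity), ← Real.sqrt_sq (by positivity : (0 : ℝ) ≤ ∑ i, ∑ j, ‖X i j‖ * ‖Y j i‖)]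
    exact Real.sqrt_le_sqrt h2
  exact h1.trans h3

/-! ### Trace pairings of word amplitudes via the transfer operator -/

/-- Entries of `M · e_a e_dᵀ · N`: `(M E_{ad} N)_{ij} = M_{ia} N_{dj}`. [folklore] -/
theorem mul_single_one_mul_apply (M N : Matrix (Fin D) (Fin D) ℂ) (a d i j : Fin D) :
    (M * Matrix.single a d (1 : ℂ) * N) i j = M i a * N d j := by
  rw [Matrix.mul_assoc, Matrix.mul_apply, Finset.sum_eq_single a]
  · rw [single_mul_apply_same, one_mul]
  · intro k _ hk
    rw [single_mul_apply_of_ne _ _ _ _ _ hk, mul_zero]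
  · intro h; exact absurd (Finset.mem_univ a) h

/-- **The Gram pairing of two word families through the transfer operator** (the mechanism of
Fannes–Nachtergaele–Werner's Lemma 5.2): for matrices `X, Y`,
`Σ_{|s| = n} conj (tr (X A^{s})) · tr (Y A^{s}) = Σ_{a,d} (Y · 𝔼ⁿ(e_a e_dᵀ) · Xᴴ)_{ad}`.
(Both sides equal `Σ_{s,a,d} (Y A^{s})_{aa} conj((X A^{s})_{dd})`.) Fannes–Nachtergaele–Werner
(1992) §5, Lemma 5.1–5.2. [cite: FannesNachtergaeleWernerCMP1992, §5 Lemma 5.2] -/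
theorem sum_conj_trace_mul_trace_eq (A : MPSTensor q D) (n : ℕ) (X Y : Matrix (Fin D) (Fin D) ℂ) :
    ∑ s : Fin n → Fin q, star ((X * wordProduct A s).trace) * (Y * wordProduct A s).trace =
      ∑ a : Fin D, ∑ d : Fin D,
        (Y * (transferOp A ^ n) (Matrix.single a d 1) * Xᴴ) a d := by
  -- termwise identity `(Y (A^s E_{ad} A^s†) Xᴴ)_{ad} = (Y A^s)_{aa} conj((X A^s)_{dd})`
  have hterm : ∀ (s : Fin n → Fin q) (a d : Fin D),
      (Y * (wordProduct A s * Matrix.single a d (1 : ℂ) * (wordProduct A s)ᴴ) * Xᴴ) a d =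
        (Y * wordProduct A s) a a * star ((X * wordProduct A s) d d) := by
    intro s a d
    rw [show Y * (wordProduct A s * Matrix.single a d (1 : ℂ) * (wordProduct A s)ᴴ) * Xᴴ =
        (Y * wordProduct A s) * Matrix.single a d (1 : ℂ) * (X * wordProduct A s)ᴴ by
      rw [conjTranspose_mul]; simp only [Matrix.mul_assoc]]
    rw [mul_single_one_mul_apply, conjTranspose_apply]
  calc ∑ s : Fin n → Fin q, star ((X * wordProduct A s).trace) * (Y * wordProduct A s).trace
      = ∑ s : Fin n → Fin q, ∑ a : Fin D, ∑ d : Fin D,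
          (Y * wordProduct A s) a a * star ((X * wordProduct A s) d d) := by
        refine Finset.sum_congr rfl fun s _ => ?_
        rw [trace, trace, star_sum, Finset.sum_mul_sum, Finset.sum_comm]
        refine Finset.sum_congr rfl fun a _ => Finset.sum_congr rfl fun d _ => ?_
        rw [diag_apply, diag_apply, mul_comm]
    _ = ∑ a : Fin D, ∑ d : Fin D, ∑ s : Fin n → Fin q,
          (Y * wordProduct A s) a a * star ((X * wordProduct A s) d d) := by
        rw [Finset.sum_comm]
        exact Finset.sum_congr rfl fun a _ => Finset.sum_comm
    _ = ∑ a : Fin D, ∑ d : Fin D, (Y * (transferOp A ^ n) (Matrix.single a d 1) * Xᴴ) a d := by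
        refine Finset.sum_congr rfl fun a _ => Finset.sum_congr rfl fun d _ => ?_
        rw [transferOp_pow_apply, Matrix.mul_sum, Matrix.sum_mul, Matrix.sum_apply]
        exact Finset.sum_congr rfl fun s _ => (hterm s a d).symm

/-- **Main term and remainder of the Gram pairing** (Fannes–Nachtergaele–Werner Lemma 5.2 in
the normalised gauge): if `𝔼ⁿ(e_a e_dᵀ) = ρ_{da} 𝟙 + R_{ad}` (so that `𝔼ⁿ → (X ↦ tr (ρ X) 𝟙)`),
then `Σ_{|s|=n} conj (tr (X A^{s})) tr (Y A^{s}) = tr (Xᴴ ρ Y) + Σ_{a,d} (Y R_{ad} Xᴴ)_{ad}`.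
Fannes–Nachtergaele–Werner (1992) §5, Lemma 5.2 (`⟨Γ_n(B), Γ_n(C)⟩ = tr (ρ …) + O(a(n))`).
[cite: FannesNachtergaeleWernerCMP1992, §5 Lemma 5.2] -/
theorem sum_conj_trace_mul_trace_eq_main_add (A : MPSTensor q D) (n : ℕ)
    (ρ : Matrix (Fin D) (Fin D) ℂ) (X Y : Matrix (Fin D) (Fin D) ℂ) :
    ∑ s : Fin n → Fin q, star ((X * wordProduct A s).trace) * (Y * wordProduct A s).trace =
      (Xᴴ * ρ * Y).trace +
        ∑ a : Fin D, ∑ d : Fin D,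
          (Y * ((transferOp A ^ n) (Matrix.single a d 1) - ρ d a • (1 : Matrix (Fin D) (Fin D) ℂ)) *
            Xᴴ) a d := by
  rw [sum_conj_trace_mul_trace_eq]
  have hsplit : ∀ a d : Fin D,
      (Y * (transferOp A ^ n) (Matrix.single a d 1) * Xᴴ) a d =
        ρ d a * (Y * Xᴴ) a d +
          (Y * ((transferOp A ^ n) (Matrix.single a d 1) - ρ d a • (1 : Matrix (Fin D) (Fin D) ℂ)) *
            Xᴴ) a d := by
    intro a d
    rw [Matrix.mul_sub, Matrix.sub_mul, Matrix.sub_apply, Matrix.mul_smul, Matrix.mul_one,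
      Matrix.smul_mul, Matrix.smul_apply, smul_eq_mul]
    ring
  simp only [hsplit, Finset.sum_add_distrib]
  congr 1
  -- `Σ_{a,d} ρ_{da} (Y Xᴴ)_{ad} = tr (ρ Y Xᴴ) = tr (Xᴴ ρ Y)`
  rw [Matrix.mul_assoc, trace_mul_comm, Matrix.mul_assoc, Finset.sum_comm, trace]
  refine Finset.sum_congr rfl fun d _ => ?_
  rw [diag_apply, Matrix.mul_apply]

/-- **The remainder is small when `𝔼ⁿ` is close to its limit**: if all entries of
`R_{ad} = 𝔼ⁿ(e_a e_dᵀ) - ρ_{da} 𝟙` are bounded by `δ`, then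
`|Σ_{a,d} (Y R_{ad} Xᴴ)_{ad}| ≤ δ (Σ |Y_{ij}|) (Σ |X_{ij}|)`. [folklore] -/
theorem norm_gram_remainder_le (A : MPSTensor q D) (n : ℕ) (ρ : Matrix (Fin D) (Fin D) ℂ)
    {δ : ℝ} (hδ : ∀ a d b c : Fin D,
      ‖((transferOp A ^ n) (Matrix.single a d 1) - ρ d a • (1 : Matrix (Fin D) (Fin D) ℂ)) b c‖ ≤ δ)
    (X Y : Matrix (Fin D) (Fin D) ℂ) :
    ‖∑ a : Fin D, ∑ d : Fin D,
        (Y * ((transferOp A ^ n) (Matrix.single a d 1) - ρ d a • (1 : Matrix (Fin D) (Fin D) ℂ)) *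
          Xᴴ) a d‖ ≤ δ * (∑ i, ∑ j, ‖Y i j‖) * (∑ i, ∑ j, ‖X i j‖) := by
  set R : Fin D → Fin D → Matrix (Fin D) (Fin D) ℂ := fun a d =>
    (transferOp A ^ n) (Matrix.single a d 1) - ρ d a • (1 : Matrix (Fin D) (Fin D) ℂ) with hR
  have hterm : ∀ a d : Fin D, ‖(Y * R a d * Xᴴ) a d‖ ≤ ∑ c, ∑ b, ‖Y a b‖ * δ * ‖X d c‖ := by
    intro a d
    rw [Matrix.mul_apply]
    refine (norm_sum_le _ _).trans (Finset.sum_le_sum fun c _ => ?_)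
    rw [norm_mul, conjTranspose_apply, norm_star, Matrix.mul_apply, ← Finset.sum_mul]
    refine mul_le_mul_of_nonneg_right ?_ (norm_nonneg _)
    refine (norm_sum_le _ _).trans (Finset.sum_le_sum fun b _ => ?_)
    rw [norm_mul]
    exact mul_le_mul_of_nonneg_left (hδ a d b c) (norm_nonneg _)
  calc ‖∑ a : Fin D, ∑ d : Fin D, (Y * R a d * Xᴴ) a d‖
      ≤ ∑ a : Fin D, ∑ d : Fin D, ‖(Y * R a d * Xᴴ) a d‖ :=
        (norm_sum_le _ _).trans (Finset.sum_le_sum fun a _ => norm_sum_le _ _)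
    _ ≤ ∑ a : Fin D, ∑ d : Fin D, ∑ c : Fin D, ∑ b : Fin D, ‖Y a b‖ * δ * ‖X d c‖ :=
        Finset.sum_le_sum fun a _ => Finset.sum_le_sum fun d _ => hterm a d
    _ = ∑ a : Fin D, ∑ d : Fin D, (∑ b : Fin D, ‖Y a b‖ * δ) * ∑ c : Fin D, ‖X d c‖ := by
        refine Finset.sum_congr rfl fun a _ => Finset.sum_congr rfl fun d _ => ?_
        rw [Finset.sum_mul_sum, Finset.sum_comm]
    _ = ∑ a : Fin D, (∑ b : Fin D, ‖Y a b‖ * δ) * ∑ d : Fin D, ∑ c : Fin D, ‖X d c‖ :=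
        Finset.sum_congr rfl fun a _ => by rw [Finset.mul_sum]
    _ = (∑ a : Fin D, ∑ b : Fin D, ‖Y a b‖ * δ) * ∑ d : Fin D, ∑ c : Fin D, ‖X d c‖ := by
        rw [Finset.sum_mul]
    _ = δ * (∑ i, ∑ j, ‖Y i j‖) * (∑ i, ∑ j, ‖X i j‖) := by
        rw [show (∑ a : Fin D, ∑ b : Fin D, ‖Y a b‖ * δ) = (∑ a : Fin D, ∑ b : Fin D, ‖Y a b‖) * δ by
          rw [Finset.sum_mul]
          exact Finset.sum_congr rfl fun a _ => by rw [Finset.sum_mul]]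
        ring

/-! ### Dual word formula and trace duality for the iterates -/

/-- Trace duality for the iterates: `tr (Y 𝔼ⁿ(X)) = tr ((𝔼†)ⁿ(Y) X)` (from `trace_mul_transferOp`
by induction). Fannes–Nachtergaele–Werner (1992) §2. [folklore] -/
theorem trace_mul_transferOp_pow (A : MPSTensor q D) (n : ℕ) (Y X : Matrix (Fin D) (Fin D) ℂ) :
    (Y * (transferOp A ^ n) X).trace = ((transferOp (fun i => (A i)ᴴ) ^ n) Y * X).trace := by
  induction n generalizing X Y with
  | zero => simp
  | succ n ih =>
    rw [pow_succ', Module.End.mul_apply, trace_mul_transferOp, ih, pow_succ, Module.End.mul_apply]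

/-- **Word formula for the dual iterates**: `Σ_{|w| = n} (A^{w})† Y A^{w} = (𝔼†)ⁿ(Y)`.
Fannes–Nachtergaele–Werner (1992) §2. [folklore] -/
theorem sum_conjTranspose_wordProduct_mul_mul (A : MPSTensor q D) (n : ℕ)
    (Y : Matrix (Fin D) (Fin D) ℂ) :
    ∑ w : Fin n → Fin q, (wordProduct A w)ᴴ * Y * wordProduct A w =
      (transferOp (fun i => (A i)ᴴ) ^ n) Y := by
  refine Matrix.ext_iff_trace_mul_right.2 fun X => ?_
  rw [← trace_mul_transferOp_pow, transferOp_pow_apply, Finset.mul_sum, Finset.sum_mul,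
    trace_sum, trace_sum]
  refine Finset.sum_congr rfl fun w _ => ?_
  rw [← Matrix.mul_assoc, ← Matrix.mul_assoc,
    trace_mul_comm (Y * wordProduct A w * X) (wordProduct A w)ᴴ]
  simp only [Matrix.mul_assoc]

/-- Concatenated words multiply: `A^{u ++ v} = A^{u} A^{v}` (`List.ofFn_fin_append`). [folklore] -/
theorem wordProduct_append (A : MPSTensor q D) {m n : ℕ} (u : Fin m → Fin q) (v : Fin n → Fin q) :
    wordProduct A (Fin.append u v) = wordProduct A u * wordProduct A v := by
  simp only [wordProduct]
  rw [show (fun i => A (Fin.append u v i)) = Fin.append (fun i => A (u i)) (fun i => A (v i)) by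
    funext i
    refine Fin.addCases (fun j => ?_) (fun j => ?_) i <;> simp,
    List.ofFn_fin_append, List.prod_append]

/-! ### Quadratic bounds from the density matrix `ρ` -/

/-- A positive semidefinite matrix is bounded by its trace: `(re tr X) 𝟙 - X ≥ 0`. [folklore] -/
theorem posSemidef_algebraMap_trace_sub {X : Matrix (Fin D) (Fin D) ℂ} (hX : X.PosSemidef) :
    (algebraMap ℝ _ X.trace.re - X).PosSemidef := by
  have hle : X ≤ algebraMap ℝ (Matrix (Fin D) (Fin D) ℂ) X.trace.re := by
    rw [le_algebraMap_iff_spectrum_le (ha := hX.1.isSelfAdjoint)]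
    intro x hx
    rw [hX.1.spectrum_real_eq_range_eigenvalues] at hx
    obtain ⟨i, rfl⟩ := hx
    have htr : X.trace.re = ∑ j, hX.1.eigenvalues j := by
      rw [hX.1.trace_eq_sum_eigenvalues, Complex.re_sum]
      exact Finset.sum_congr rfl fun j _ => Complex.ofReal_re _
    rw [htr]
    exact Finset.single_le_sum (f := hX.1.eigenvalues) (fun j _ => hX.eigenvalues_nonneg j)
      (Finset.mem_univ i)
  exact Matrix.le_iff.1 hle

/-- A density matrix is bounded by the identity: `ρ ≥ 0`, `tr ρ = 1 ⇒ 𝟙 - ρ ≥ 0`. [folklore] -/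
theorem posSemidef_one_sub_of_trace_eq_one {ρ : Matrix (Fin D) (Fin D) ℂ} (hρ : ρ.PosSemidef)
    (htr : ρ.trace = 1) : (1 - ρ).PosSemidef := by
  have h := posSemidef_algebraMap_trace_sub hρ
  rwa [htr, Complex.one_re, map_one] at h

/-- `re tr (Cᴴ M C) ≥ 0` for `M ≥ 0`. [folklore] -/
theorem re_trace_conjTranspose_mul_mul_nonneg {M : Matrix (Fin D) (Fin D) ℂ} (hM : M.PosSemidef)
    (C : Matrix (Fin D) (Fin D) ℂ) : 0 ≤ ((Cᴴ * M * C).trace).re :=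
  (Complex.nonneg_iff.1 (hM.conjTranspose_mul_mul_same C).trace_nonneg).1

/-- **Lower `ρ`-bound**: if `ρ ≥ λ 𝟙` then `re tr (Cᴴ ρ C) ≥ λ Σ |C_{ij}|²`. [folklore] -/
theorem mul_sum_norm_sq_le_re_trace {ρ : Matrix (Fin D) (Fin D) ℂ} {lam : ℝ}
    (h : (ρ - (lam : ℂ) • (1 : Matrix (Fin D) (Fin D) ℂ)).PosSemidef) (C : Matrix (Fin D) (Fin D) ℂ) :
    lam * ∑ i, ∑ j, ‖C i j‖ ^ 2 ≤ ((Cᴴ * ρ * C).trace).re := by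
  have h0 := re_trace_conjTranspose_mul_mul_nonneg h C
  rw [Matrix.mul_sub, Matrix.sub_mul, trace_sub, Complex.sub_re, Matrix.mul_smul, Matrix.mul_one,
    Matrix.smul_mul, trace_smul, smul_eq_mul, Complex.re_ofReal_mul,
    trace_conjTranspose_mul_self_re] at h0
  linarith

/-- **Upper `ρ`-bound**: if `ρ ≤ 𝟙` then `re tr (Cᴴ ρ C) ≤ Σ |C_{ij}|²`. [folklore] -/
theorem re_trace_le_sum_norm_sq {ρ : Matrix (Fin D) (Fin D) ℂ} (h : (1 - ρ).PosSemidef)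
    (C : Matrix (Fin D) (Fin D) ℂ) :
    ((Cᴴ * ρ * C).trace).re ≤ ∑ i, ∑ j, ‖C i j‖ ^ 2 := by
  have h0 := re_trace_conjTranspose_mul_mul_nonneg h C
  rw [Matrix.mul_sub, Matrix.sub_mul, trace_sub, Complex.sub_re, Matrix.mul_one,
    trace_conjTranspose_mul_self_re] at h0
  linarith

/-! ### Sums of Hilbert–Schmidt norms of word families -/

/-- In the normalised gauge the words of every length resolve the identity:
`Σ_{|u| = a} A^{u} A^{u}† = 𝔼ᵃ(𝟙) = 𝟙`. Fannes–Nachtergaele–Werner (1992) §5 (5.3.b). [folklore] -/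
theorem sum_wordProduct_mul_conjTranspose (A : MPSTensor q D) (h1 : transferOp A 1 = 1) (a : ℕ) :
    ∑ u : Fin a → Fin q, wordProduct A u * (wordProduct A u)ᴴ = 1 := by
  have h := transferOp_pow_apply A a 1
  simp only [Matrix.mul_one] at h
  rw [← h, pow_apply_of_apply_eq _ h1]

/-- **Right multiplication by the words is an isometry in the normalised gauge**:
`Σ_{|u| = a} Σ |(X A^{u})_{ij}|² = Σ |X_{ij}|²` when `𝔼(𝟙) = 𝟙` (since `Σ_u A^{u} A^{u}† = 𝔼ᵃ(𝟙) = 𝟙`).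
Fannes–Nachtergaele–Werner (1992) §5 (5.3.b). [folklore] -/
theorem sum_sum_norm_sq_mul_wordProduct (A : MPSTensor q D) (h1 : transferOp A 1 = 1) (a : ℕ)
    (X : Matrix (Fin D) (Fin D) ℂ) :
    ∑ u : Fin a → Fin q, ∑ i, ∑ j, ‖(X * wordProduct A u) i j‖ ^ 2 = ∑ i, ∑ j, ‖X i j‖ ^ 2 := by
  have hE := sum_wordProduct_mul_conjTranspose A h1 a
  have h : ∑ u : Fin a → Fin q, ((X * wordProduct A u)ᴴ * (X * wordProduct A u)).trace =
      (Xᴴ * X).trace := by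
    have e : ∀ u : Fin a → Fin q, ((X * wordProduct A u)ᴴ * (X * wordProduct A u)).trace =
        (Xᴴ * (X * (wordProduct A u * (wordProduct A u)ᴴ))).trace := by
      intro u
      rw [conjTranspose_mul, Matrix.mul_assoc, trace_mul_comm]
      simp only [Matrix.mul_assoc]
    simp only [e, ← trace_sum, ← Finset.mul_sum, hE, Matrix.mul_one]
  have h' := congrArg Complex.re h
  rw [Complex.re_sum] at h'
  simpa only [trace_conjTranspose_mul_self_re] using h'

/-- **Left multiplication by the words is bounded in the normalised gauge**:
`Σ_{|t| = c} Σ |(A^{t} X)_{ij}|² = re tr (Xᴴ (𝔼†)ᶜ(𝟙) X) ≤ λ⁻¹ re tr (Xᴴ ρ X) ≤ λ⁻¹ Σ |X_{ij}|²`, using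
`𝟙 ≤ λ⁻¹ ρ`, positivity of `(𝔼†)ᶜ`, `(𝔼†)ᶜ(ρ) = ρ` and `ρ ≤ 𝟙`. Fannes–Nachtergaele–Werner (1992)
§5, proof of Lemma 6.2 (the estimate of `Σ ‖v(μ^ℓ)^* Φ(μ^r)‖²`). [folklore] -/
theorem sum_sum_norm_sq_wordProduct_mul_le (A : MPSTensor q D) {ρ : Matrix (Fin D) (Fin D) ℂ}
    (hρ : transferOp (fun i => (A i)ᴴ) ρ = ρ) (hρ1 : (1 - ρ).PosSemidef) {lam : ℝ} (hlam : 0 < lam)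
    (hlamρ : (ρ - (lam : ℂ) • (1 : Matrix (Fin D) (Fin D) ℂ)).PosSemidef) (c : ℕ)
    (X : Matrix (Fin D) (Fin D) ℂ) :
    ∑ t : Fin c → Fin q, ∑ i, ∑ j, ‖(wordProduct A t * X) i j‖ ^ 2 ≤
      lam⁻¹ * ∑ i, ∑ j, ‖X i j‖ ^ 2 := by
  -- `Σ_t |A^t X|² = re tr (Xᴴ (𝔼†)ᶜ(𝟙) X)`
  have hsum : ∑ t : Fin c → Fin q, ∑ i, ∑ j, ‖(wordProduct A t * X) i j‖ ^ 2 =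
      ((Xᴴ * (transferOp (fun i => (A i)ᴴ) ^ c) 1 * X).trace).re := by
    rw [← sum_conjTranspose_wordProduct_mul_mul, Finset.mul_sum, Finset.sum_mul, trace_sum,
      Complex.re_sum]
    refine Finset.sum_congr rfl fun t _ => ?_
    rw [← trace_conjTranspose_mul_self_re, conjTranspose_mul, Matrix.mul_one]
    simp only [Matrix.mul_assoc]
  -- positivity of `(𝔼†)ᶜ` applied to `λ⁻¹ ρ - 𝟙 ≥ 0`
  have hZ : ((lam⁻¹ : ℂ) • ρ - 1).PosSemidef := by
    have e : (lam⁻¹ : ℂ) • ρ - 1 = (lam⁻¹ : ℝ) • (ρ - (lam : ℂ) • (1 : Matrix (Fin D) (Fin D) ℂ)) := by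
      rw [smul_sub, ← Complex.coe_smul, ← Complex.coe_smul, smul_smul, Complex.ofReal_inv,
        inv_mul_cancel₀ (Complex.ofReal_ne_zero.2 hlam.ne'), one_smul]
    rw [e]
    exact hlamρ.smul (inv_nonneg.2 hlam.le)
  have hT := pow_posSemidef_of_posSemidef (transferOp fun i => (A i)ᴴ)
    (fun Z hZ => transferOp_posSemidef _ hZ) c hZ
  rw [map_sub, LinearMap.map_smul, pow_apply_of_apply_eq _ hρ] at hT
  have h0 := re_trace_conjTranspose_mul_mul_nonneg hT X
  rw [Matrix.mul_sub, Matrix.sub_mul, trace_sub, Complex.sub_re, Matrix.mul_smul, Matrix.smul_mul,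
    trace_smul, smul_eq_mul] at h0
  have hre : ((lam⁻¹ : ℂ) * (Xᴴ * ρ * X).trace).re = lam⁻¹ * ((Xᴴ * ρ * X).trace).re := by
    rw [← Complex.ofReal_inv, Complex.re_ofReal_mul]
  rw [hre] at h0
  have hup := re_trace_le_sum_norm_sq hρ1 X
  rw [hsum]
  have := mul_le_mul_of_nonneg_left hup (inv_nonneg.2 hlam.le)
  linarith

end QLattice

end Literature.MathematicalPhysics.QuantumLattice
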